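import Summits.HubbardSuperconductivity.HubbardLadder.Bounds.ThermalMottStiffnessCeiling
import HarnessLib

/-!
# Hubbard ladder — Bounds: the thermal hole–doublon KINETIC ceiling at `T > 0`, `t–t'` class —
# `𝒦(ρ_β) ≲ 2(|t| + 2|t'|)·n_h + O(t²/U) + O(T/U)` with ONE entropy term
# (bounds.tex Thm 7_T(xi); part 1 of 2 — part 2 = `ThermalStrongCouplingStiffnessCeiling.lean`)

HONEST FRAMING (cell pub-hubbard): ladder R1–R4 with certified numbers; no claim on H/H₀. These are
bounds for a MODEL CLASS — the `t–t'` Hubbard torus `hubbardTorusTT' L 1 t' U` on `(ℤ/Lℤ)²`, every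
real `t'`, every filling at or below half filling, `U > 8(1 + |t'|)`, in canonical sector Gibbs
states at `β > 0` — and no materials claim. Companion text: `pub-hubbard/paper/bounds.tex` §7
(Theorem 7_T, Corollary 7.2); tables `pub-hubbard/pub-hubbard-bounds/BOUNDS.md` (row T5_T) and
`EXTREMISERS.md` §5p.

Part 2 of the `T = 0` series (`StrongCouplingStiffnessCeilingTPrime.lean`, Thm 7(vii)–(x)) proves
`limsup_{U→∞} ρ_s ≤ (|t| + 2|t'|) n_h` for ground states by hole–doublon counting. This module runs
the counting argument at the level of SECTOR GIBBS STATES, paying the entropy ONCE: (b) the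
Nagaoka–Brinkman–Rice counting inequality of `HubbardNNNHoppingHoleCounting.lean` for the hopping
`(1, 2t')` is a VARIATIONAL floor `E₀(H^{t,2t'}(U'); N) ≥ -4(1 + 2|t'|)((L² - N) + ωL²)` at
`U' = 4(1 + 2|t'|)(2 + 2ω⁻¹)` (`holeCounting_le_groundEnergy_hubbardTorusTT'`), hence a BLOCK
OPERATOR inequality on every `N`-particle coordinate sector inherited by every sector Gibbs state
(`le_re_gibbsState_toBlock_of_le_groundEnergy`): `-Re⟨H^{t,2t'}(0)|_p⟩ ≤ 4(1 + 2|t'|)((L² - N) +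
ωL² + (2 + 2ω⁻¹)⟨D⟩_{β,p})`; (c) the thermal doublon chord: the same floor at `U₁` (hopping `(1, t')`,
`U₁ ≥ (1 + |t'|)(8 + 8ω₁⁻¹)`) read in the Gibbs state of `H^{t,t'}(U)|_p`, and the thermal upper
bracket `Re⟨H(U)|_p⟩_β ≤ E₀(H(U)|_p) + (log N_p)/β ≤ 0 + (log N_p)/β`
(`re_gibbsState_self_le_groundEnergy_add`; a doublon-free configuration of the sector has zero
diagonal energy), give `(U - U₁)⟨D⟩_{β,p} ≤ 4(1 + |t'|)((L² - N) + ω₁L²) + (log N_p)/β`.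

## What is proved (no `sorry`, no new axioms; `τ := 1 + |t'|`, `τ₂ := 1 + 2|t'|`, `N_p := dim p`,
## `c := 2 + 2ω⁻¹`)

* `holeCounting_le_groundEnergy_hubbardTorusTT'` — the counting floor as an `N`-particle variational
  bound (all `S^z`): `-4(|t| + |t'|)((L² - N) + ωL²) ≤ E₀(H^{tt'}(U); N)` for `U ≥ (|t| + |t'|)(8 + 8ω⁻¹)`.
* `neg_re_gibbsState_hoppingTwo_le_counting` — (b) above, every coordinate `N`-sector, every `β`.
* `re_gibbsState_doubleOcc_le_thermal_chord` — (c) above.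
* `neg_re_gibbsState_hoppingTwo_le_holeDoublon` — **Thm 7_T(xi), tree form** (`2m ≤ L²`, `p` a
  `2m`-particle sector containing every `(m↑, m↓)` configuration): `-Re⟨H^{t,2t'}(0)|_p⟩_{β,p} ≤
  4τ₂((L² - 2m) + ωL² + c(4τ((L² - 2m) + ω₁L²) + (log N_p)/β)/(U - U₁))` — UNCONDITIONAL.
* `ThermalHoleDoublonKineticCeilingTT'` / `…_holds` — the node, `p` the `(2m, S^z = 0)` sector. Per
  site and direction (`𝒦₁ = -Re⟨H^{t,2t'}(0)⟩/(2L²)` by the rotation invariance of the sector state):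
  `𝒦₁(ρ_β) ≤ 2τ₂(n_h + ω + c(4τ n_h + 4τω₁ + T(log N_p)/L²)/(U - U₁))`, i.e.
  **`limsup_{U→∞} 𝒦₁(ρ_β) ≤ 2(|t| + 2|t'|) n_h` at every temperature** — the quantity entering
  bounds.tex Thm 1(c) (`𝒟 ≤ 𝒦₁`) and the NK₂-conditional `T_c` corollary (Cor. 7.2:
  `T_c ≤ (π/4)(|t| + 2|t'|) n_h + o(1)` as `U → ∞`, the HVR/PTR constant with the HOLE density).

Honest numbers: informative only for `U ≫ 8(1 + |t'|)` and `T ≲ t`; the entropy correction is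
`4τ₂ c T (log N_p)/(U - U₁) ≤ 4τ₂ c T L² log 4/(U - U₁)`.
References (keys of `lean/references.bib`): Nagaoka1966 §II; BrinkmanRice1970; Tasaki1998 §3.2, §6.3;
HazraVermaRanderia2019 §III, App. G; ParamekantiTrivediRanderia1998 eq. (3), §IV; Tasaki2020 §2.1.
-/

noncomputable section

namespace Summit.HubbardSuperconductivity.HubbardLadder.Bounds

open Matrix Finset Real
open Literature.MathematicalPhysics.QuantumLattice
open Literature.MathematicalPhysics.QuantumFieldTheory
open Literature.Probability.LatticeModels
open Literature.MathematicalPhysics.QuantumLattice.ThermodynamicLimit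
open scoped ComplexOrder ComplexConjugate

variable {L : ℕ} [NeZero L]

/-! ### The hole-counting floor as an `N`-particle variational bound -/

/-- **Counting floor, variational form** (any real `t`, `t'`; `ω > 0`, `U ≥ (|t| + |t'|)(8 + 8ω⁻¹)`,
`N ≤ 2L²`): `-4(|t| + |t'|)((L² - N) + ωL²) ≤ E₀(H^{tt'}_L(U); N)`, the infimum over ALL unit
`N`-particle vectors (every `S^z`) — the counting inequality
`holeCounting_le_re_expect_hubbardTorusTT'` with its doublon term discarded (`D ≥ 0`, coefficient `≥ 0`). -/
theorem holeCounting_le_groundEnergy_hubbardTorusTT' {t t' U ω : ℝ} (hω : 0 < ω)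
    (hU : (|t| + |t'|) * (8 + 8 * ω⁻¹) ≤ U) {N : ℕ}
    (hN : N ≤ Fintype.card (Orb (FermionTorus 2 L))) :
    -(4 * (|t| + |t'|) * (((L : ℝ) ^ 2 - N) + ω * (L : ℝ) ^ 2)) ≤
      Literature.MathematicalPhysics.QuantumLattice.groundEnergy (hubbardTorusTT' L t t' U) N := by
  unfold Literature.MathematicalPhysics.QuantumLattice.groundEnergy
  refine le_csInf (groundEnergySet_nonempty _ hN) ?_
  rintro E ⟨ψ, hψN, hψ1, rfl⟩
  have h := holeCounting_le_re_expect_hubbardTorusTT' t t' U hω hψN hψ1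
  have hDnn : 0 ≤ (star ψ ⬝ᵥ ((∑ x : FermionTorus 2 L, numberOp x 0 * numberOp x 1) *ᵥ ψ)).re := by
    rw [re_expect_interaction_eq_sum]
    positivity
  have hcoef : 0 ≤ U - 4 * (|t| + |t'|) * (2 + 2 * ω⁻¹) := by nlinarith [hU]
  unfold Literature.MathematicalPhysics.QuantumLattice.expect
  nlinarith [mul_nonneg hcoef hDnn]

omit [NeZero L] in
/-- A non-empty coordinate sector of `N`-particle configurations witnesses `N ≤ 2L²`. -/
theorem card_le_card_orb_of_sector {N : ℕ} (p : Finset (Orb (FermionTorus 2 L)) → Prop)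
    [Nonempty {a // p a}] (hpN : ∀ s, p s → s.card = N) :
    N ≤ Fintype.card (Orb (FermionTorus 2 L)) := by
  obtain ⟨⟨s, hs⟩⟩ := ‹Nonempty {a // p a}›
  rw [← hpN s hs]
  exact Finset.card_le_univ s

/-! ### (b) The counting bound in a sector Gibbs state -/

/-- **Counting bound in a sector Gibbs state** (any real `t'`, `U`, `β`; `ω > 0`; `p` a non-empty
coordinate sector of `N`-particle configurations): with `⟨·⟩` the Gibbs state of `H^{t,t'}(U)|_p`,
`-Re⟨H^{t,2t'}(0)|_p⟩ ≤ 4(1 + 2|t'|)((L² - N) + ωL² + (2 + 2ω⁻¹) Re⟨D|_p⟩)` — the variational floor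
for the hopping `(1, 2t')` at `U' = 4(1 + 2|t'|)(2 + 2ω⁻¹)` is a block operator inequality
(`le_re_gibbsState_toBlock_of_le_groundEnergy`) and `H^{t,2t'}(U') = H^{t,2t'}(0) + U'D`. -/
theorem neg_re_gibbsState_hoppingTwo_le_counting (t' U β : ℝ) {ω : ℝ} (hω : 0 < ω) {N : ℕ}
    (p : Finset (Orb (FermionTorus 2 L)) → Prop) [DecidablePred p] [Nonempty {a // p a}]
    (hpN : ∀ s, p s → s.card = N) :
    -(gibbsState β ((hubbardTorusTT' L 1 t' U).toBlock p p)
        ((hubbardTorusTT' L 1 (2 * t') 0).toBlock p p)).re ≤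
      4 * (1 + 2 * |t'|) * (((L : ℝ) ^ 2 - N) + ω * (L : ℝ) ^ 2 +
        (2 + 2 * ω⁻¹) * (gibbsState β ((hubbardTorusTT' L 1 t' U).toBlock p p)
          ((∑ x : FermionTorus 2 L, numberOp x 0 * numberOp x 1).toBlock p p)).re) := by
  set D : Matrix (Finset (Orb (FermionTorus 2 L))) (Finset (Orb (FermionTorus 2 L))) ℂ :=
    ∑ x : FermionTorus 2 L, numberOp x 0 * numberOp x 1 with hD
  set H := hubbardTorusTT' L 1 t' U with hH
  set H₂ := hubbardTorusTT' L 1 (2 * t') 0 with hH₂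
  have hHp : (H.toBlock p p).IsHermitian := (hubbardTorusTT'_isHermitian L 1 t' U).submatrix _
  obtain ⟨U', hU'⟩ : ∃ U' : ℝ, U' = 4 * (1 + 2 * |t'|) * (2 + 2 * ω⁻¹) := ⟨_, rfl⟩
  have hUle : (|(1 : ℝ)| + |2 * t'|) * (8 + 8 * ω⁻¹) ≤ U' := by
    rw [abs_one, abs_mul, abs_two, hU']
    exact le_of_eq (by ring)
  have hfl := holeCounting_le_groundEnergy_hubbardTorusTT' (L := L) hω hUle
    (card_le_card_orb_of_sector p hpN)
  have hge : -(4 * (|(1 : ℝ)| + |2 * t'|) * (((L : ℝ) ^ 2 - N) + ω * (L : ℝ) ^ 2)) ≤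
      (gibbsState β (H.toBlock p p) ((hubbardTorusTT' L 1 (2 * t') U').toBlock p p)).re := by
    -- (`convert` bridges the generic lemma's `ι`-derived decidability instances)
    convert le_re_gibbsState_toBlock_of_le_groundEnergy
      (hubbardTorusTT'_isHermitian L 1 (2 * t') U') hfl p hpN hHp β
  have hHU' : hubbardTorusTT' L 1 (2 * t') U' = H₂ + (U' : ℂ) • D := by
    rw [hH₂, hD, hubbardTorusTT'_eq_add_smul_doubleOcc (2 * t') 0 U', sub_zero]
  have e : (hubbardTorusTT' L 1 (2 * t') U').toBlock p p = H₂.toBlock p p + (U' : ℂ) • D.toBlock p p := by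
    rw [hHU']
    ext i j
    rfl
  rw [e, map_add, map_smul, Complex.add_re, smul_eq_mul, Complex.re_ofReal_mul, abs_one, abs_mul,
    abs_two, hU'] at hge
  linarith

/-! ### (c) The thermal doublon chord -/

/-- **Thermal doublon chord** (any real `t'`; `ω₁ > 0`, `(1 + |t'|)(8 + 8ω₁⁻¹) ≤ U₁ < U`, `β > 0`;
`p` a non-empty coordinate sector of `N`-particle configurations containing a configuration of
non-positive diagonal energy, `N_p = dim p`): the Gibbs state of `H^{t,t'}(U)|_p` has
`Re⟨D|_p⟩_β ≤ (4(1 + |t'|)((L² - N) + ω₁L²) + (log N_p)/β)/(U - U₁)` — the counting floor at `U₁`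
as a block operator inequality, `H(U₁) = H(U) + (U₁ - U)D`, and `Re⟨H(U)|_p⟩_β ≤ E₀(H(U)|_p) +
(log N_p)/β ≤ (log N_p)/β`. -/
theorem re_gibbsState_doubleOcc_le_thermal_chord (t' : ℝ) {U U₁ ω₁ β : ℝ} (hω₁ : 0 < ω₁)
    (hU₁ : (1 + |t'|) * (8 + 8 * ω₁⁻¹) ≤ U₁) (hU : U₁ < U) (hβ : 0 < β) {N : ℕ}
    (p : Finset (Orb (FermionTorus 2 L)) → Prop) [DecidablePred p] [Nonempty {a // p a}]
    (hpN : ∀ s, p s → s.card = N)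
    (hfree : ∃ s, p s ∧ (hubbardTorusTT' L 1 t' U s s).re ≤ 0) :
    (gibbsState β ((hubbardTorusTT' L 1 t' U).toBlock p p)
        ((∑ x : FermionTorus 2 L, numberOp x 0 * numberOp x 1).toBlock p p)).re ≤
      (4 * (1 + |t'|) * (((L : ℝ) ^ 2 - N) + ω₁ * (L : ℝ) ^ 2) +
        Real.log (Fintype.card {a // p a}) / β) / (U - U₁) := by
  set D : Matrix (Finset (Orb (FermionTorus 2 L))) (Finset (Orb (FermionTorus 2 L))) ℂ :=
    ∑ x : FermionTorus 2 L, numberOp x 0 * numberOp x 1 with hD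
  set H := hubbardTorusTT' L 1 t' U with hH
  have hHp : (H.toBlock p p).IsHermitian := (hubbardTorusTT'_isHermitian L 1 t' U).submatrix _
  set d : ℝ := (gibbsState β (H.toBlock p p) (D.toBlock p p)).re with hd
  -- (1) the thermal upper bracket `Re⟨H⟩_β ≤ 0 + (log N_p)/β`
  have hup : (gibbsState β (H.toBlock p p) (H.toBlock p p)).re ≤
      Real.log (Fintype.card {a // p a}) / β := by
    have h1 := re_gibbsState_self_le_groundEnergy_add hHp hβ
    obtain ⟨s, hs, hs0⟩ := hfree
    have hE0 : (H.toBlock p p).groundEnergy ≤ 0 :=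
      (groundEnergy_toBlock_le_re_apply (hubbardTorusTT'_isHermitian L 1 t' U) p s hs).trans hs0
    linarith
  -- (2) the counting floor at `U₁`, read in the Gibbs state
  have hUle : (|(1 : ℝ)| + |t'|) * (8 + 8 * ω₁⁻¹) ≤ U₁ := by rwa [abs_one]
  have hfl := holeCounting_le_groundEnergy_hubbardTorusTT' (L := L) hω₁ hUle
    (card_le_card_orb_of_sector p hpN)
  have hge : -(4 * (|(1 : ℝ)| + |t'|) * (((L : ℝ) ^ 2 - N) + ω₁ * (L : ℝ) ^ 2)) ≤
      (gibbsState β (H.toBlock p p) ((hubbardTorusTT' L 1 t' U₁).toBlock p p)).re := by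
    convert le_re_gibbsState_toBlock_of_le_groundEnergy
      (hubbardTorusTT'_isHermitian L 1 t' U₁) hfl p hpN hHp β
  have hHU₁ : hubbardTorusTT' L 1 t' U₁ = H + ((U₁ - U : ℝ) : ℂ) • D := by
    rw [hH, hD]
    exact hubbardTorusTT'_eq_add_smul_doubleOcc t' U U₁
  have e : (hubbardTorusTT' L 1 t' U₁).toBlock p p = H.toBlock p p + ((U₁ - U : ℝ) : ℂ) • D.toBlock p p := by
    rw [hHU₁]
    ext i j
    rfl
  rw [e, map_add, map_smul, Complex.add_re, smul_eq_mul, Complex.re_ofReal_mul, ← hd, abs_one] at hge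
  rw [le_div_iff₀ (sub_pos.2 hU)]
  linarith

/-! ### Thm 7_T(xi): the thermal hole–doublon KINETIC ceiling (unconditional) -/

omit [NeZero L] in
/-- A `(2m, S^z = 0)`-type sector with `2m ≤ L²` contains a DOUBLON-FREE configuration
`A↑ ∪ B↓`, `A ∩ B = ∅`, `#A = #B = m`, whose diagonal energy vanishes. -/
theorem exists_doublonFree_of_sector (t' U : ℝ) {m : ℕ} (hmL : 2 * m ≤ L ^ 2)
    (p : Finset (Orb (FermionTorus 2 L)) → Prop)
    (hsec : ∀ s, (upPart s).card = m ∧ (downPart s).card = m → p s) :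
    ∃ s, p s ∧ (hubbardTorusTT' L 1 t' U s s).re ≤ 0 := by
  classical
  have hcard : 2 * m ≤ (Finset.univ : Finset (FermionTorus 2 L)).card := by
    rw [Finset.card_univ, NoGo.card_fermionTorus_two]; exact hmL
  obtain ⟨C, -, hC⟩ := Finset.exists_subset_card_eq hcard
  have hnC : m ≤ C.card := by omega
  obtain ⟨A, hAC, hA⟩ := Finset.exists_subset_card_eq hnC
  have hBcard : (C \ A).card = m := by
    rw [Finset.card_sdiff, Finset.inter_eq_left.2 hAC, hC, hA]
    omega
  have hAB : Disjoint A (C \ A) := Finset.disjoint_sdiff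
  refine ⟨pairSet A (C \ A), hsec _ ⟨by rw [upPart_pairSet, hA], by rw [downPart_pairSet, hBcard]⟩, ?_⟩
  have h0 := star_single_pairSet_hubbardTorusTT'_eq_zero t' U hAB
  rw [Literature.Computability.AlgebraicComplexity.star_single_dotProduct_mulVec_single] at h0
  exact h0.le

/-- **Thm 7_T(xi), tree form — the thermal hole–doublon kinetic ceiling** (any real `t'`;
`ω, ω₁ > 0`, `(1 + |t'|)(8 + 8ω₁⁻¹) ≤ U₁ < U`, `β > 0`, `2m ≤ L²`, `p` a coordinate sector of
`2m`-particle configurations containing every `(m↑, m↓)` configuration, `N_p = dim p`): the Gibbs state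
of `H^{t,t'}(U)|_p` has `-Re⟨H^{t,2t'}(0)|_p⟩_{β,p} ≤ 4(1 + 2|t'|)((L² - 2m) + ωL² +
(2 + 2ω⁻¹)(4(1 + |t'|)((L² - 2m) + ω₁L²) + (log N_p)/β)/(U - U₁))`. No stiffness hypothesis. -/
theorem neg_re_gibbsState_hoppingTwo_le_holeDoublon (t' : ℝ) {U U₁ ω ω₁ β : ℝ} (hω : 0 < ω)
    (hω₁ : 0 < ω₁) (hU₁ : (1 + |t'|) * (8 + 8 * ω₁⁻¹) ≤ U₁) (hU : U₁ < U) (hβ : 0 < β) {m : ℕ}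
    (hmL : 2 * m ≤ L ^ 2)
    (p : Finset (Orb (FermionTorus 2 L)) → Prop) [DecidablePred p] [Nonempty {a // p a}]
    (hpN : ∀ s, p s → s.card = 2 * m)
    (hsec : ∀ s, (upPart s).card = m ∧ (downPart s).card = m → p s) :
    -(gibbsState β ((hubbardTorusTT' L 1 t' U).toBlock p p)
        ((hubbardTorusTT' L 1 (2 * t') 0).toBlock p p)).re ≤
      4 * (1 + 2 * |t'|) * (((L : ℝ) ^ 2 - (2 * m : ℕ)) + ω * (L : ℝ) ^ 2 +
        (2 + 2 * ω⁻¹) * ((4 * (1 + |t'|) * (((L : ℝ) ^ 2 - (2 * m : ℕ)) + ω₁ * (L : ℝ) ^ 2) +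
          Real.log (Fintype.card {a // p a}) / β) / (U - U₁))) := by
  have hcount := neg_re_gibbsState_hoppingTwo_le_counting (L := L) t' U β hω p hpN
  have hchord := re_gibbsState_doubleOcc_le_thermal_chord (L := L) t' hω₁ hU₁ hU hβ p hpN
    (exists_doublonFree_of_sector t' U hmL p hsec)
  have hc : (0 : ℝ) ≤ 4 * (1 + 2 * |t'|) * (2 + 2 * ω⁻¹) := by positivity
  have hcD := mul_le_mul_of_nonneg_left hchord hc
  linarith

/-- **Thm 7_T(xi) (thermal hole–doublon kinetic ceiling; PROVED below).** `L ≥ 1`, any real `t'`,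
`ω, ω₁ > 0`, `(1 + |t'|)(8 + 8ω₁⁻¹) ≤ U₁ < U`, `β > 0`, `2m ≤ L²`, `p` the `(2m, S^z = 0)` coordinate
sector (`|s| = 2m`, `2 · #{i ∈ s : spin i = 0} = 2m`), `N_p = dim p = binom(L², m)²`: the sector Gibbs
state of `hubbardTorusTT' L 1 t' U` has `-Re⟨H^{t,2t'}(0)|_p⟩_{β,p} ≤ 4(1 + 2|t'|)((L² - 2m) + ωL² +
(2 + 2ω⁻¹)(4(1 + |t'|)((L² - 2m) + ω₁L²) + (log N_p)/β)/(U - U₁))`; per site and direction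
(`𝒦₁ = -Re⟨H^{t,2t'}(0)⟩/(2L²)`, rotation invariance): `𝒦₁(ρ_β) ≤ 2(1 + 2|t'|)(n_h + ω + …)`, i.e.
`limsup_{U→∞} 𝒦₁(ρ_β) ≤ 2(|t| + 2|t'|) n_h` at every `T`. kind: support (PROVED). Why it might fail:
it cannot; informative only for `U ≫ 8(1 + |t'|)` and `T ≲ t`. Sources: Nagaoka1966 §II;
BrinkmanRice1970; HazraVermaRanderia2019 §III, App. G; this cell (Thm 7(vii)). -/
@[conjecture] def ThermalHoleDoublonKineticCeilingTT' : Prop :=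
  ∀ (L : ℕ) [NeZero L] (t' U U₁ β ω ω₁ : ℝ) (m : ℕ), 0 < ω → 0 < ω₁ →
    (1 + |t'|) * (8 + 8 * ω₁⁻¹) ≤ U₁ → U₁ < U → 0 < β → 2 * m ≤ L ^ 2 →
    let p : Finset (Orb (FermionTorus 2 L)) → Prop := fun s =>
      s.card = 2 * m ∧ 2 * (s.filter fun i => (ofLex i).2 = 0).card = 2 * m
    (-(gibbsState β ((hubbardTorusTT' L 1 t' U).toBlock p p)
        ((hubbardTorusTT' L 1 (2 * t') 0).toBlock p p)).re) ≤
      4 * (1 + 2 * |t'|) * (((L : ℝ) ^ 2 - (2 * m : ℕ)) + ω * (L : ℝ) ^ 2 +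
        (2 + 2 * ω⁻¹) * ((4 * (1 + |t'|) * (((L : ℝ) ^ 2 - (2 * m : ℕ)) + ω₁ * (L : ℝ) ^ 2) +
          Real.log (Fintype.card {s // p s}) / β) / (U - U₁)))

/-- **`ThermalHoleDoublonKineticCeilingTT'` holds.** -/
theorem thermalHoleDoublonKineticCeilingTT'_holds : ThermalHoleDoublonKineticCeilingTT' := by
  intro L _ t' U U₁ β ω ω₁ m hω hω₁ hU₁ hU hβ hmL
  dsimp only
  set p : Finset (Orb (FermionTorus 2 L)) → Prop := fun s =>
    s.card = 2 * m ∧ 2 * (s.filter fun i => (ofLex i).2 = 0).card = 2 * m with hp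
  haveI : Nonempty {a // p a} := nonempty_spinZeroSector (L := L) (by omega)
  exact neg_re_gibbsState_hoppingTwo_le_holeDoublon t' hω hω₁ hU₁ hU hβ hmL p (fun s hs => hs.1)
    (fun s hs => spinZeroSector_of_card_upPart_downPart hs)

end Summit.HubbardSuperconductivity.HubbardLadder.Bounds

end
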